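/-
Summits.AnomalousDissipation.HardCores — GENERATED by harness/kit/hardcore_registry.py (2026-08-18T11:48:14Z) from harness/kit/hardcore_seeds.json (FILTER-SYNTHESIS 2026-08-18 F1).
Tags existing OPEN statement items as famous open sub-summit problems (`@[hard_core]`); the kernel tribunal (t1h) flags routes whose crux meets one
(frontier shelf, never a fail; the owner route is exempt). 1 item(s) tagged; 0 unresolved: []
NEVER import this from a Theorems/Theses/Cruxes file.
-/
import Summits.AnomalousDissipation.AnomalousDissipation.Theses.EnsembleRigidity
import HarnessLib.Audit.TribunalTags

-- stmt-AnomalousDissipation-15509 · GPMeanBoundedFamily · nu-uniform mean-energy bound for fixed force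
attribute [hard_core "AnomalousDissipation" "nu-uniform mean-energy bound for fixed force"] Summit.AnomalousDissipation.AnomalousDissipation.Theses.EnsembleRigidity.GPMeanBoundedFamily
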